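import Summits.BirchSwinnertonDyer.BirchSwinnertonDyer.Theses.KimAtThreeKolyvagin
import HarnessLib

/-!
# Route `KimAtThreeKolyvagin` (rung W2): definitions the route's tribunal posits

One definition, nothing asserted: `KimAtThreeRankZeroPUBOnKatoStratum`, the route's leaf
`N11.KimAtThreeRankZeroPUB` (Kim, arXiv:2505.09121 Thm 1.1/1.2 at `p = 3`, analytic rank `0`,
`E(ℚ₃)[3] = 0`: `∂^{(∞)}(δ̃) = d ∈ ℕ` and `∂⁽⁰⁾(δ̃) = ord₃ #Ш(E/ℚ)(3) + d`) RESTRICTED to the regime of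
the proved rung `KimAtThreeKolyvaginDeepUpperRung.deepUpperAtThree_truncation_potGood_of_kato2004`
(Kato 2004 Thm. 14.5 (3) / Prop. 14.16 (2): `3` additive and potentially good, `3 ∤ ∏ c_ℓ`, the
period transfer `Ω(W) = u · Ω⁺_f` with `|u|₃ = 1`, a parametrisation datum with `3 ∤ c_D`). This is
the tribunal's `s_case` (D-0034 T3): the S-restricted case, which must NOT be provable for the rung to
sit outside the leaf's known regime — and it is not: on this stratum print gives only Kato's
INEQUALITY `ord₃ #Ш(3) ≤ ∂⁽⁰⁾(δ̃)` (the rung), while the EQUALITY with the defect term `∂^{(∞)}` is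
Kim's announced `p = 3` theorem (PRE; cell memo `kim3/KIM3-PROOF.md`, referee PASS, not a kernel
proof). `kimAtThreeRankZeroPUBOnKatoStratum_of_leaf` certifies that it IS a restriction of the leaf.
[cite: Kim2025RefinedTNC, Thm 1.1, Thm 1.2] [cite: Kato2004Asterisque, Thm. 14.5 (3) (p. 236), Prop. 14.16 (2) (p. 244)]
-/

set_option autoImplicit false
-- the Theorems namespace of a single-conjunct summit repeats the summit name by design (D-0017)
set_option linter.dupNamespace false

noncomputable section

open scoped MatrixGroups ModularForm Classical

open CongruenceSubgroup WeierstrassCurve Literature.NumberTheory.EllipticCurves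
  Literature.NumberTheory.EllipticCurves.ModularForms

namespace Summit.BirchSwinnertonDyer.BirchSwinnertonDyer.Theorems.KimAtThreeKolyvaginDefs

open Summit.BirchSwinnertonDyer.Rank1Residual.Additive

/-- **The leaf `N11.KimAtThreeRankZeroPUB` restricted to Kato's printed stratum** (the tribunal's
S-restricted case for the rung `deepUpperAtThree_truncation_potGood_of_kato2004`): for `W/ℚ` globally
minimal with `ρ̄_{E,3^n}` onto for all `n`, `#E(ℚ₃)[3] = 1`, `Ш(E/ℚ)` finite, `f` the newform of `W`
with `3`-integral plus symbols and `ord(δ̃) = 0`, `3` ADDITIVE and POTENTIALLY GOOD, `3 ∤ ∏ c_ℓ`,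
`Ω(W) = u · Ω⁺_f` with `|u|₃ = 1`, and a parametrisation datum `D` with `3 ∤ c_D`:
`∂^{(∞)}(δ̃) = d ∈ ℕ` and `∂⁽⁰⁾(δ̃) = ord₃ #Ш(E/ℚ)(3) + d`. OPEN (Kim's `p = 3` equality; print has only
the inequality `≤` here). A `Prop`; nothing asserted.
[cite: Kim2025RefinedTNC, Thm 1.1, Thm 1.2] [cite: Kato2004Asterisque, Thm. 14.5 (3) (p. 236)] -/
@[conjecture] def KimAtThreeRankZeroPUBOnKatoStratum : Prop :=
  ∀ (W : WeierstrassCurve ℚ) [W.IsElliptic] [W.IsGloballyMinimal],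
    (∀ n : ℕ, W.HasSurjectiveModNGaloisRep (3 ^ n : ℕ)) →
    Nat.card {Q : (W.baseChange ℚ_[3]).toAffine.Point // (3 : ℕ) • Q = 0} = 1 →
    Finite W.sha →
    ∀ {N : ℕ} [NeZero N] (f : CuspForm (Gamma0 N) 2), IsNewformOf W f →
    (∀ r : ℚ, ratPlusSymbol f r ≠ 0 → 0 ≤ padicValRat 3 (ratPlusSymbol f r)) →
    kuriharaVanishingOrder W 3 f = 0 →
    ¬ W.HasGoodReductionAtPrime 3 → ¬ W.HasMultiplicativeReductionAtPrime 3 →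
    0 ≤ padicValRat 3 W.j →
    ¬ 3 ∣ W.tamagawaProduct →
    (∃ u : ℚ, ‖(u : ℚ_[3])‖ = 1 ∧ W.realPeriodRat = u * plusPeriod f) →
    ∀ {N' : ℕ} [NeZero N'] (D : ModularParametrizationData W N'), ¬ (3 : ℤ) ∣ D.maninConstant →
      ∃ d : ℕ, kuriharaPartialInfty W 3 f = d ∧
        kuriharaPartial W 3 f 0 =
          ((padicValNat 3 (Nat.card (AddCommGroup.primaryComponent W.sha 3)) + d : ℕ) : ℕ∞)

/-- The restricted case follows from the leaf (it IS a restriction: the stratum binders are ignored).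
[cite: Kim2025RefinedTNC, Thm 1.1] -/
theorem kimAtThreeRankZeroPUBOnKatoStratum_of_leaf (h : N11.KimAtThreeRankZeroPUB) :
    KimAtThreeRankZeroPUBOnKatoStratum := by
  intro W _ _ htower ht0 hfin N _ f hf hint hord _ _ _ _ _ N' _ _ _
  exact h W htower ht0 hfin f hf hint hord

end Summit.BirchSwinnertonDyer.BirchSwinnertonDyer.Theorems.KimAtThreeKolyvaginDefs

/-! ## The TWO-EXPONENT Kato–Kurihara dictionary at `3` (the additive-DEFECT rows of the off-Kato-stratum cruxes
19562 / 19599 / 19679: Kodaira IV/IV* `3 ∣ c₃`, `3 ∣` Manin constant; appended by seat `bsd-addord-w2-acc6`,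
PROGRAMME PART 1b, plan g16 ACCEL-LIST (6) / plan g17 BRIEF/ACC 2026-08-26T14:36:01Z «one additive-defect object,
shared by acc1/acc3/acc6»; w2-c4 g5 WANTED 14:43:44Z «PORT_nonadd@3 + its IV/IV* two-exponent sibling»)

Three `Prop`-valued PREDICATES (missing-input / port statements; NOTHING asserted, no `_holds`; FLAG
`K22-Thm3.13-PORT@3`, the SAME debt line as n1011's `KatoKuriharaDictionaryThreeAt₂At` / `KatoKuriharaPortThreeAtWith₂`)
and two one-line certifications that at `e = 0` they are IMPLIED by n1011's one-exponent predicates on the Kato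
stratum (so nothing landed is contradicted or strengthened).  WHY TWO EXPONENTS.  n1011's (DICT3) clause
`Λ(loc_{v₃} κ_d) = u_d · 3^t · δ̃_{n(d)}` (Kim AJM 148 Thm. 3.13 read at `3`) is typed under the antecedents
`3 ∤ c₃`, `3 ∤ c_P` and the `3`-adic period transfer `Ω(W) = u·Ω⁺_{P.f}`, `|u|₃ = 1`: there the local lattice is
`exp*_ω(H¹(ℚ₃,T₃E)) = 3^{−t}ℤ₃·ω` (Kim AJM Lemma 3.9, `p ∤ c_p`).  On Kodaira IV/IV* (`c₃ = 3`) the lattice is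
`3^{v₃(c₃)−t}ℤ₃·ω` (the general display of Kim AJM §3.2.3 with Thm. 3.6; the specialisation Rem. 3.7 / Lemma 3.9 is
stated for `p ∤ c_p` only; cell memo kim3/KIM3-PROOF.md Lemma L/L′, referee PASS), and for a datum `P` with
`3 ∣ c_P` the tree's `Ω⁺_{P.f}`-normalised Kurihara numbers are `c_P`-multiples of Kim's `Ω(W)`-normalised ones
(`KimAtThreeShallowEqDeepPeriod.exists_optimal_period_ratio`: `Ω(W) = u·Ω⁺_f`, `‖u‖₃ = ‖c₀‖₃ ≤ 1`).  Both shifts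
land on the `Λ`-side of the value law as ONE exponent `e = v₃(c₃) + v₃(c_P)`, the same at every level and every
depth: `3^e · Λ(loc_{v₃} κ_d) = u_d · 3^t · δ̃_{n(d)}`.  The consumer
(`KimAtThreeTwoExponentAssembly.pow_dvd_natCard_selmerGroup_of_certificate_twoExp`) shows that `e` CANCELS in the
END argument, so the predicates carry `e` as a free parameter and drop the three antecedents.
SCOPE.  This is the ADDITIVE half («IV/IV* two-exponent sibling») of the cell's definition item
`defn-KatoKuriharaDictionaryThreeNonAddAt` (plan g17 COORD 2026-08-26T16:36:01Z (2)); the NON-ADDITIVE half — antecedent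
`Good W 3 ∨ Mult W 3`, value law twisted by the Euler factor at `3` (`(1 − a₃·3⁻¹ + 𝟙_good·3⁻¹)` at `∅`,
`(1 − a₃χ(3)3⁻¹ + 𝟙_good·χ(3)²3⁻¹)` at conductor-`n` characters; Kato 2004 Thm. 12.5, Kim AJM 148 Thm. 3.13, Kim 2025
§5), lattice `3^{v₃(#Ẽ(𝔽₃)) − t − 1}ℤ₃` (good) / the Tate-curve lattice (mult) — stays that OPEN definition item (it
needs a shifted-Kurihara-number / group-ring Euler-operator currency, cf. n1011's `GroupRingEulerFactorComparison`,
`KolyvaginEulerFactorOperatorRat`; not typed here).  acc1's single-depth free-exponent witness family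
(`KatoKuriharaWitnessAt W k e Dk v₃ D κ Λ κ′`, seat bsd-addord-w2-acc1) follows from the predicates below by scaling
Kato's families by `3^e` (`κ ↦ 3^e • κ`); the two-level (COMP) clause kept here is what the certificate / LOWER road
(`KimAtThreeTwoExponentAssembly`) consumes.
References: [Kim2022StructureSelmer] §3.2.3, Thm. 3.6, Rem. 3.7, Lemma 3.9, Thm. 3.13 (arXiv pp. 16–18);
[Kato2004Asterisque] Thm. 12.5 (1); [MazurRubin2004] Def. 3.1.3, Thm. 3.2.4, App. A (33); [Sakamoto2024] Def. 4.1;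
[Kim2025RefinedTNC] §5, §8.1.2 (the Tamagawa-`3` example). -/

namespace Summit.BirchSwinnertonDyer.BirchSwinnertonDyer.Theorems.KimAtThreeKolyvaginDefs

open scoped NumberField ContRepresentation
open NumberField IsDedekindDomain Literature.NumberTheory.GaloisRepresentations
  Literature.NumberTheory.GaloisRepresentations.DiscreteGaloisModule Literature.NumberTheory.GaloisCohomology
  Literature.NumberTheory.EllipticCurves.Rank1Residual Summit.BirchSwinnertonDyer.Rank1Residual.GaloisImage

/-- **The witness clauses of the TWO-EXPONENT dictionary at ONE depth `k`** — n1011's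
`KatoKuriharaWitnessAt W k t D v₃ P κ Λ κ′` with the value clause (DICT3) replaced by
`3^e · Λ(loc_{v₃} κ_d) = u_d · 3^t · δ̃_{n(d)}` and every other clause VERBATIM: (0) `κ_d ∈ H¹_{𝓕_can(d)}`,
(I4) `κ′ ∈ KS₁(E[3^{k+1}], 𝓕_can, 𝒫)` with `κ′_d − κ_d ∈ ℤ-span{κ_c : c ⊊ d}`, (Λ) `Λ` onto `ℤ/3^{k+1}` on
`𝓕_can(v₃)` with kernel the Kummer part.  In print `e = v₃(c₃) + v₃(c_P)` (`= 0` on the Kato stratum, where this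
IS `KatoKuriharaWitnessAt`: `katoKuriharaWitnessAtTwoExp_zero_of_witnessAt`).  A predicate; nothing asserted.
[cite: Kim2022StructureSelmer, Thm. 3.13 and §3.2.3–§3.4.1 (arXiv pp. 16–18)]
[cite: MazurRubin2004, Thm. 3.2.4 and App. A (33)] [cite: Kato2004Asterisque, Thm. 12.5 (1)] -/
def KatoKuriharaWitnessAtTwoExp (W : WeierstrassCurve ℚ) [W.IsElliptic] [W.IsGloballyMinimal]
    (k t e : ℕ) (D : KolyvaginDatum (W.torsionGaloisModule (((3 : ℕ) : ℤ) ^ k * ((3 : ℕ) : ℤ))))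
    (v₃ : HeightOneSpectrum (𝓞 ℚ)) {N : ℕ} [NeZero N] (P : ModularParametrizationData W N)
    (κ : Finset (HeightOneSpectrum (𝓞 ℚ)) →
      galoisCohomology (W.torsionGaloisModule (((3 : ℕ) : ℤ) ^ k * ((3 : ℕ) : ℤ))) 1)
    (Λ : galoisCohomology ((W.torsionGaloisModule (((3 : ℕ) : ℤ) ^ k * ((3 : ℕ) : ℤ))).toLocal
      (Sum.inr v₃)) 1 →+ ZMod (3 ^ (k + 1)))
    (κ' : Finset (HeightOneSpectrum (𝓞 ℚ)) →
      galoisCohomology (W.torsionGaloisModule (((3 : ℕ) : ℤ) ^ k * ((3 : ℕ) : ℤ))) 1) : Prop :=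
  haveI : Fact (Nat.Prime 3) := ⟨Nat.prime_three⟩
  -- (0)
  (∀ d, D.IsLevel d → κ d ∈ (D.atLevel (propagatedSelmerStructure W 3 k) d).selmerGroup) ∧
  -- (I4), with the Kolyvagin system `κ′` exposed
  (κ' ∈ D.kolyvaginSystems (propagatedSelmerStructure W 3 k) ∧ ∀ d, D.IsLevel d →
      κ' d - κ d ∈ AddSubgroup.closure {x | ∃ c, c ⊂ d ∧ x = κ c}) ∧
  -- (Λ)
  (∀ r : ZMod (3 ^ (k + 1)), ∃ x ∈ propagatedSelmerStructure W 3 k (Sum.inr v₃), Λ x = r) ∧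
  (∀ x ∈ propagatedSelmerStructure W 3 k (Sum.inr v₃),
      Λ x = 0 ↔ x ∈ W.kummerSelmerStructure (((3 : ℕ) : ℤ) ^ k * ((3 : ℕ) : ℤ)) (Sum.inr v₃)) ∧
  -- (DICT3, two-exponent form)
  ∀ (d : Finset (HeightOneSpectrum (𝓞 ℚ))), D.IsLevel d →
    ∃ (u : (ZMod (3 ^ (k + 1)))ˣ)
      (ψ : (ℓ : ℕ) → (ZMod ℓ)ˣ →* Multiplicative (ZMod (3 ^ (k + 1)))),
      (∀ q ∈ d, Function.Surjective (ψ (Ideal.absNorm q.asIdeal))) ∧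
      haveI : NeZero (∏ q ∈ d, Ideal.absNorm q.asIdeal) :=
        ⟨Finset.prod_ne_zero_iff.2 fun q _ h => q.ne_bot (Ideal.absNorm_eq_zero_iff.1 h)⟩
      ((3 ^ e : ℕ) : ZMod (3 ^ (k + 1))) *
          Λ (galoisCohomology.localization _ (Sum.inr v₃) 1 (κ d)) =
        (u : ZMod (3 ^ (k + 1))) * (3 : ZMod (3 ^ (k + 1))) ^ t *
          Literature.NumberTheory.EllipticCurves.kuriharaNumber P.f (3 ^ (k + 1))
            (∏ q ∈ d, Ideal.absNorm q.asIdeal) ψ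

/-- **The TWO-EXPONENT dictionary, two-level form AT ONE PARAMETRISATION DATUM `P`** — n1011's
`KatoKuriharaDictionaryThreeAt₂At W t k k′ D D′ red v₃ P` with the witness predicate replaced by
`KatoKuriharaWitnessAtTwoExp … e …` at both depths and the three antecedents `¬ 3 ∣ c₃`, `¬ 3 ∣ c_P`,
`Ω(W) = u·Ω⁺_{P.f} (|u|₃ = 1)` DELETED (they fail on the additive-defect rows, whose content the exponent `e`
carries); the remaining antecedents (`k ≤ k′`, the pin of `red`, `Addv W 3`, surj(3), `#E(ℚ₃)[3] = 3^t`, `v₃ ∣ 3`)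
and the conclusion (witnesses at both depths, (COMP) `red_*(κu_d) = κ_d`, `red_*(κu′_d) = κ′_d`) VERBATIM.  FLAG
`K22-Thm3.13-PORT@3` (same debt line); NOT in print at `3`; a predicate, nothing asserted.
[cite: Kim2022StructureSelmer, Thm. 3.13 and §2.2.2, §3.2.3–§3.4.1 (arXiv pp. 12, 16–18)]
[cite: MazurRubin2004, Def. 3.1.3, Thm. 3.2.4 and App. A (33)] [cite: Kato2004Asterisque, Thm. 12.5 (1)] -/
def KatoKuriharaDictionaryThreeAt₂AtTwoExp (W : WeierstrassCurve ℚ) [W.IsElliptic] [W.IsGloballyMinimal]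
    (t e k k' : ℕ)
    (D : KolyvaginDatum (W.torsionGaloisModule (((3 : ℕ) : ℤ) ^ k * ((3 : ℕ) : ℤ))))
    (D' : KolyvaginDatum (W.torsionGaloisModule (((3 : ℕ) : ℤ) ^ k' * ((3 : ℕ) : ℤ))))
    (red : (W.torsionGaloisModule (((3 : ℕ) : ℤ) ^ k' * ((3 : ℕ) : ℤ))).toContRepresentation →ⁱL
      (W.torsionGaloisModule (((3 : ℕ) : ℤ) ^ k * ((3 : ℕ) : ℤ))).toContRepresentation)
    (v₃ : HeightOneSpectrum (𝓞 ℚ)) {N : ℕ} [NeZero N] (P : ModularParametrizationData W N) : Prop :=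
  haveI : Fact (Nat.Prime 3) := ⟨Nat.prime_three⟩
  k ≤ k' →
  -- `red` IS the reduction `x ↦ 3^{k′−k} x` (pinned on the underlying geometric points)
  (∀ x : geomTorsion W (((3 : ℕ) : ℤ) ^ k' * ((3 : ℕ) : ℤ)),
      ((red x : geomTorsion W (((3 : ℕ) : ℤ) ^ k * ((3 : ℕ) : ℤ))) : geomPoints W) =
        (((3 : ℕ) : ℤ) ^ (k' - k)) • (x : geomPoints W)) →
  Addv W 3 →
  W.HasSurjectiveModNGaloisRep ((3 : ℕ) : ℤ) →
  Nat.card {Q : (W.baseChange ℚ_[3]).toAffine.Point // (3 : ℕ) • Q = 0} = 3 ^ t →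
  ((3 : ℕ) : 𝓞 ℚ) ∈ v₃.asIdeal →
    ∃ (κ : Finset (HeightOneSpectrum (𝓞 ℚ)) →
          galoisCohomology (W.torsionGaloisModule (((3 : ℕ) : ℤ) ^ k * ((3 : ℕ) : ℤ))) 1)
      (Λ : galoisCohomology ((W.torsionGaloisModule (((3 : ℕ) : ℤ) ^ k * ((3 : ℕ) : ℤ))).toLocal
          (Sum.inr v₃)) 1 →+ ZMod (3 ^ (k + 1)))
      (κ' : Finset (HeightOneSpectrum (𝓞 ℚ)) →
          galoisCohomology (W.torsionGaloisModule (((3 : ℕ) : ℤ) ^ k * ((3 : ℕ) : ℤ))) 1)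
      (κu : Finset (HeightOneSpectrum (𝓞 ℚ)) →
          galoisCohomology (W.torsionGaloisModule (((3 : ℕ) : ℤ) ^ k' * ((3 : ℕ) : ℤ))) 1)
      (Λu : galoisCohomology ((W.torsionGaloisModule (((3 : ℕ) : ℤ) ^ k' * ((3 : ℕ) : ℤ))).toLocal
          (Sum.inr v₃)) 1 →+ ZMod (3 ^ (k' + 1)))
      (κu' : Finset (HeightOneSpectrum (𝓞 ℚ)) →
          galoisCohomology (W.torsionGaloisModule (((3 : ℕ) : ℤ) ^ k' * ((3 : ℕ) : ℤ))) 1),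
      KatoKuriharaWitnessAtTwoExp W k t e D v₃ P κ Λ κ' ∧
      KatoKuriharaWitnessAtTwoExp W k' t e D' v₃ P κu Λu κu' ∧
      -- (COMP) one Euler system: the depth-`k′` families reduce to the depth-`k` families
      ∀ d, D'.IsLevel d → D.IsLevel d →
        galoisCohomology.map red 1 (κu d) = κ d ∧ galoisCohomology.map red 1 (κu' d) = κ' d

/-- **PORT₂ — the TWO-EXPONENT shared-generator closure AT ONE PARAMETRISATION DATUM `P`** — n1011's
PORT″ `KatoKuriharaPortThreeAtWith₂ W t v₃ η P` with the `P`-keyed two-level dictionary replaced by its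
two-exponent form: for ALL depths `k, k′`, ALL `τ`-data `D`, `D′` canonical for THE SAME generator family `η`
(With-guards at `k + t`, `k′ + t`) and every `red`, `KatoKuriharaDictionaryThreeAt₂AtTwoExp W t e k k′ D D′ red v₃ P`.
The RESIDUAL OBJECT of the additive-defect rows of cruxes 19562 / 19599 / 19679 (in print `e = v₃(c₃) + v₃(c_P)`):
FLAG `K22-Thm3.13-PORT@3`; NOT in print at `3` (Kim AJM Thm. 3.13 is `p ≥ 5` and `p ∤ c_p·c_P`; Kim–Pollack
arXiv:2505.09121 §4.2 states a uniform-constant dictionary at `p ≥ 3`, PRE); to be ASSUMED by its consumer,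
never `_holds` here; its discharger-to-be is ★ PK-6₂'s road (`KatoKuriharaPortThreeOfZetaBody`) with the
IV/IV* lattice lemma.  A predicate; nothing asserted. [cite: Kim2022StructureSelmer, Thm. 3.13 (arXiv p. 17)]
[cite: Sakamoto2024, §2 and Def. 4.1] [cite: Kim2025RefinedTNC, §4.2 and §8.1.2] -/
def KatoKuriharaPortThreeAtWith₂TwoExp (W : WeierstrassCurve ℚ) [W.IsElliptic] [W.IsGloballyMinimal]
    (t e : ℕ) (v₃ : HeightOneSpectrum (𝓞 ℚ))
    (eta : (q : HeightOneSpectrum (𝓞 ℚ)) → (ZMod (Ideal.absNorm q.asIdeal))ˣ)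
    {N : ℕ} [NeZero N] (P : ModularParametrizationData W N) : Prop :=
  ∀ (k k' : ℕ) (D : KolyvaginDatum (W.torsionGaloisModule (((3 : ℕ) : ℤ) ^ k * ((3 : ℕ) : ℤ))))
    (D' : KolyvaginDatum (W.torsionGaloisModule (((3 : ℕ) : ℤ) ^ k' * ((3 : ℕ) : ℤ))))
    (red : (W.torsionGaloisModule (((3 : ℕ) : ℤ) ^ k' * ((3 : ℕ) : ℤ))).toContRepresentation →ⁱL
      (W.torsionGaloisModule (((3 : ℕ) : ℤ) ^ k * ((3 : ℕ) : ℤ))).toContRepresentation),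
    D.IsCanonicalTauDatumThreeAtWith W (k + t) k eta → D'.IsCanonicalTauDatumThreeAtWith W (k' + t) k' eta →
      KatoKuriharaDictionaryThreeAt₂AtTwoExp W t e k k' D D' red v₃ P

variable {W : WeierstrassCurve ℚ} [W.IsElliptic] [W.IsGloballyMinimal]

/-- **At `e = 0` the two-exponent witness clauses ARE n1011's** (`3^0 · x = x`): nothing here is stronger
than what the Kato stratum already displays. [cite: Kim2022StructureSelmer, Thm. 3.13 (arXiv p. 17)] -/
theorem katoKuriharaWitnessAtTwoExp_zero_of_witnessAt {k t : ℕ}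
    {D : KolyvaginDatum (W.torsionGaloisModule (((3 : ℕ) : ℤ) ^ k * ((3 : ℕ) : ℤ)))}
    {v₃ : HeightOneSpectrum (𝓞 ℚ)} {N : ℕ} [NeZero N] {P : ModularParametrizationData W N}
    {κ : Finset (HeightOneSpectrum (𝓞 ℚ)) →
      galoisCohomology (W.torsionGaloisModule (((3 : ℕ) : ℤ) ^ k * ((3 : ℕ) : ℤ))) 1}
    {Λ : galoisCohomology ((W.torsionGaloisModule (((3 : ℕ) : ℤ) ^ k * ((3 : ℕ) : ℤ))).toLocal
      (Sum.inr v₃)) 1 →+ ZMod (3 ^ (k + 1))}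
    {κ' : Finset (HeightOneSpectrum (𝓞 ℚ)) →
      galoisCohomology (W.torsionGaloisModule (((3 : ℕ) : ℤ) ^ k * ((3 : ℕ) : ℤ))) 1}
    (h : KatoKuriharaWitnessAt W k t D v₃ P κ Λ κ') : KatoKuriharaWitnessAtTwoExp W k t 0 D v₃ P κ Λ κ' := by
  obtain ⟨h0, hI4, hon, hker, hdict⟩ := h
  refine ⟨h0, hI4, hon, hker, fun d hd => ?_⟩
  obtain ⟨u, ψ, hψ, hL⟩ := hdict d hd
  exact ⟨u, ψ, hψ, by simpa using hL⟩

/-- **On the Kato stratum PORT″ ⟹ PORT₂ at `e = 0`**: given the three antecedents PORT″ carries and PORT₂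
drops (`3 ∤ c₃`, `3 ∤ c_P`, the period transfer), n1011's `KatoKuriharaPortThreeAtWith₂ W t v₃ η P` implies
`KatoKuriharaPortThreeAtWith₂TwoExp W t 0 v₃ η P` — so the kernel refutation of the universal-closure PORT and
every displayed-PORT″ record are untouched by this append. [cite: Kim2022StructureSelmer, Thm. 3.13 (arXiv p. 17)] -/
theorem katoKuriharaPortThreeAtWith₂TwoExp_zero_of_portThreeAtWith₂ {t : ℕ} {v₃ : HeightOneSpectrum (𝓞 ℚ)}
    {eta : (q : HeightOneSpectrum (𝓞 ℚ)) → (ZMod (Ideal.absNorm q.asIdeal))ˣ}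
    {N : ℕ} [NeZero N] {P : ModularParametrizationData W N}
    (hc3 : ¬ 3 ∣ (W.baseChange ℚ_[3]).localTamagawaNumber ℤ_[3])
    (hcP : ¬ ((3 : ℕ) : ℤ) ∣ P.maninConstant)
    (hper : ∃ u : ℚ, ‖(u : ℚ_[3])‖ = 1 ∧
      W.realPeriodRat = u * Literature.NumberTheory.EllipticCurves.ModularForms.plusPeriod P.f)
    (h : KatoKuriharaPortThreeAtWith₂ W t v₃ eta P) : KatoKuriharaPortThreeAtWith₂TwoExp W t 0 v₃ eta P := by
  intro k k' D D' red hD hD' hk hred hadd hsurj ht hv₃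
  obtain ⟨κ, Λ, κ', κu, Λu, κu', hW, hW', hcomp⟩ := h k k' D D' red hD hD' hk hred hadd hc3 hsurj ht hv₃ hcP hper
  exact ⟨κ, Λ, κ', κu, Λu, κu', katoKuriharaWitnessAtTwoExp_zero_of_witnessAt hW,
    katoKuriharaWitnessAtTwoExp_zero_of_witnessAt hW', hcomp⟩

end Summit.BirchSwinnertonDyer.BirchSwinnertonDyer.Theorems.KimAtThreeKolyvaginDefs

end
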